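import Summits.ValiantsHypothesis.ValiantsHypothesis.Theorems.TwoProducts.RankTwoJacobianTowerSpecials
import Mathlib.Analysis.LocallyConvex.Separation
import Mathlib.Analysis.Convex.Extreme
import Mathlib.Analysis.Convex.Topology

/-!
# Rank-two Jacobian, P4d: Stage D (the TOWER INDUCTION) and Stage B (vertices are chart-unique tops or horizontal extremes)

Stage D: `ne_zero_of_isEdgeDir`, `support_pderiv_deg`, `section Tower` (★ `Eset_step`, ★★ `tower` — abstract in the three kernel lemmas), `deg1_lt_of_totalDegree`.
Stage B: `emb_inj`, `Tset`, `Hmax`, `Hmin`, `card_Tset_le`, `f_emb`, ★ `extreme_subset`, ★ `nv_le : nv F ≤ |Eset 1 F| + |Eset (−1) F| + 4`.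

P4 «TowerKernel» port (val-lit-p3 g18, desk #461 (D)/#465 (C); critic of record val-idea-crit-8 g3 CONTENT GO 03:36:15Z, VERDICT #38 «K13 K1
`rankTwoCompositionLaw` KERNEL ✓») of `section TowerKernel` (l.645–1593) of val-idea-35 g9's crux workfile `Cruxes/TwoProducts/RankTwoJacobian_val_idea_35_g9.lean`
@a021fde990ed (sha16 2c954d16062836ab, 1595 l., 0 sorry) — bodies VERBATIM, namespace `…Cruxes.TwoProducts.ValIdea35g9` → `…Theorems.TwoProducts.RankTwoJacobian`,
split at the Stage seams for the 400-line lint (TowerCharts = charts + Stage A; TowerExceptional = Stage C up to `Eset`; TowerSpecials = Stage C from `Spec`;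
TowerInduction = Stages D + B; Tower = Stage E + K1), one-line docstrings added where the workfile had none; over ✓ P1–P3 `…RankTwoJacobian{,Ostrowski,Axial}`.
HONEST LABEL: K13 K1 = the decided sub-class «affine table rank ≤ 2» of the SIDE ladder «table-rank-ladder» of crux `stmt-ValiantsHypothesis-5906` (`TwoProducts`);
0 distance on `ResidualLawV25`; nothing here closes 5906 / `PlanarCellBound`; VP ≠ VNP is NOT proved.  `--supports stmt-ValiantsHypothesis-5906 --as helper`.
Credit: val-idea-35 g9 (everything).  No instances, no notation, no named facts. [folklore]
-/

noncomputable section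
set_option linter.dupNamespace false

namespace Summit.ValiantsHypothesis.ValiantsHypothesis.Theorems.TwoProducts.RankTwoJacobian

open scoped BigOperators Pointwise
open MvPolynomial

section TowerKernel
open scoped Classical

/-! ### Stage D: the tower induction (abstract in the three kernel lemmas) -/

/-- A polynomial with an edge direction is nonzero. [folklore] -/
theorem ne_zero_of_isEdgeDir {ν : Fin 2 → ℝ} {F : Poly2} (h : IsEdgeDir ν F) : F ≠ 0 := by
  rintro rfl
  obtain ⟨p, hp, -⟩ := h
  simp at hp

/-- `∂₁` lowers the `X₁`-degree of support points. [folklore] -/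
theorem support_pderiv_deg {Q : Poly2} {s : Expo} (hs : s ∈ (pderiv 1 Q).support) :
    s + Finsupp.single 1 1 ∈ Q.support := by
  rw [MvPolynomial.mem_support_iff, coeff_pderiv] at hs
  rw [MvPolynomial.mem_support_iff]
  intro h; apply hs; rw [h, zero_mul]

section Tower
variable {σ : ℝ} (hσ : σ = 1 ∨ σ = -1) (w₁ w₂ J : Poly2) (Jf : Poly2 → Poly2)
  (hAT : ∀ (ν : Fin 2 → ℝ) (F : Poly2) (e : Expo), F ≠ 0 → IsAxialLead ν w₁ e → IsEdgeDir ν F →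
    IsSpecial ν F e ∨ IsEdgeDir ν (Jf F))
  (hCR : ∀ Q : Poly2, Jf (aeval ![w₁, w₂] Q) = aeval ![w₁, w₂] (pderiv 1 Q) * J)
  (hO : ∀ (ν : Fin 2 → ℝ) (F G : Poly2), F ≠ 0 → G ≠ 0 →
    (IsEdgeDir ν (F * G) ↔ IsEdgeDir ν F ∨ IsEdgeDir ν G))
include hσ hAT hCR hO

/-- **Tower step.** `Eset (P(w₁,w₂)) ⊆ Spec ∪ Eset ((∂_{W₂}P)(w₁,w₂))` up to the chart bookkeeping. [val-idea-35 g9] -/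
theorem Eset_step (hS : (S1 w₁).Nonempty) (Q : Poly2) :
    Eset σ (aeval ![w₁, w₂] Q) ⊆
      Xc σ w₁ ∪ Spec σ w₁ (aeval ![w₁, w₂] Q) ∪ Eset σ (aeval ![w₁, w₂] (pderiv 1 Q)) ∪ Eset σ J := by
  intro μ hμ
  have hedge := (mem_Eset hσ).mp hμ
  by_cases hX : μ ∈ Xc σ w₁
  · exact Finset.mem_union_left _ (Finset.mem_union_left _ (Finset.mem_union_left _ hX))
  obtain ⟨e, hlead⟩ := axialLead_of_not_mem hσ hS hX
  rcases hAT (dir σ μ) _ e (ne_zero_of_isEdgeDir hedge) hlead hedge with hsp | hJ'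
  · apply Finset.mem_union_left; apply Finset.mem_union_left; apply Finset.mem_union_right
    unfold Spec
    exact Finset.mem_filter.mpr ⟨mem_EV_of_tie hσ hedge, hX, e, hlead, hsp⟩
  · rw [hCR Q] at hJ'
    by_cases h1 : aeval ![w₁, w₂] (pderiv 1 Q) = 0
    · exfalso; rw [h1, zero_mul] at hJ'; exact ne_zero_of_isEdgeDir hJ' rfl
    by_cases h2 : J = 0
    · exfalso; rw [h2, mul_zero] at hJ'; exact ne_zero_of_isEdgeDir hJ' rfl
    rcases (hO _ _ _ h1 h2).mp hJ' with h | h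
    · apply Finset.mem_union_left; apply Finset.mem_union_right; exact (mem_Eset hσ).mpr h
    · apply Finset.mem_union_right; exact (mem_Eset hσ).mpr h

/-- **The tower induction** on `deg_{W₂} P`: exceptional directions of `P(w₁,w₂)` are special or come from `J(w₂,w₁)`. [val-idea-35 g9] -/
theorem tower (hS : (S1 w₁).Nonempty) :
    ∀ (n : ℕ) (Q : Poly2), (∀ s ∈ Q.support, s 1 < n) →
      (Eset σ (aeval ![w₁, w₂] Q)).card ≤ n * (3 * (Xc σ w₁).card + 2 + (Eset σ J).card) := by
  intro n
  induction n with
  | zero =>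
    intro Q hQ
    have hQ0 : Q = 0 := by
      by_contra h
      obtain ⟨d, hd⟩ := MvPolynomial.ne_zero_iff.mp h
      exact absurd (hQ d (MvPolynomial.mem_support_iff.mpr hd)) (Nat.not_lt_zero _)
    subst hQ0
    rw [map_zero, Eset_zero]; simp
  | succ n ih =>
    intro Q hQ
    have hQ' : ∀ s ∈ (pderiv 1 Q).support, s 1 < n := by
      intro s hs
      have := hQ _ (support_pderiv_deg hs)
      simp only [Finsupp.add_apply, Finsupp.single_eq_same] at this
      omega
    have ih' := ih (pderiv 1 Q) hQ'
    have hstep := Eset_step hσ w₁ w₂ J Jf hAT hCR hO hS Q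
    have hsp := card_Spec_le hσ w₁ (aeval ![w₁, w₂] Q)
    calc (Eset σ (aeval ![w₁, w₂] Q)).card
        ≤ (Xc σ w₁ ∪ Spec σ w₁ (aeval ![w₁, w₂] Q) ∪ Eset σ (aeval ![w₁, w₂] (pderiv 1 Q)) ∪ Eset σ J).card :=
          Finset.card_le_card hstep
      _ ≤ (Xc σ w₁).card + (Spec σ w₁ (aeval ![w₁, w₂] Q)).card +
            (Eset σ (aeval ![w₁, w₂] (pderiv 1 Q))).card + (Eset σ J).card := by
          refine (Finset.card_union_le _ _).trans (Nat.add_le_add_right ?_ _)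
          refine (Finset.card_union_le _ _).trans (Nat.add_le_add_right ?_ _)
          exact Finset.card_union_le _ _
      _ ≤ (n + 1) * (3 * (Xc σ w₁).card + 2 + (Eset σ J).card) := by nlinarith [hsp, ih']

end Tower

/-- Support points have `X₁`-degree `< totalDegree + 1`. [folklore] -/
theorem deg1_lt_of_totalDegree (P : Poly2) : ∀ s ∈ P.support, s 1 < P.totalDegree + 1 := by
  intro s hs
  have h1 : s 1 ≤ s.sum (fun _ e => e) := by
    by_cases h : (1 : Fin 2) ∈ s.support
    · exact Finset.single_le_sum (fun j _ => Nat.zero_le (s j)) h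
    · rw [Finsupp.notMem_support_iff.mp h]; exact Nat.zero_le _
  have h2 := le_totalDegree hs
  omega

/-! ### Stage B: vertices are chart-unique tops (or the two horizontal extremes) -/

/-- `emb` is injective (stated pointwise; the `Function.Injective emb` form dedup-collides with an unrelated Literature `emb`). [folklore] -/
theorem emb_inj {a b : Expo} (h : emb a = emb b) : a = b := by
  ext i
  have := congrFun h i
  simp only [emb] at this
  exact_mod_cast this

/-- Chart-unique tops of `supp F` in the chart `σ`. [val-idea-35 g9] -/
def Tset (σ : ℝ) (F : Poly2) : Finset Expo := F.support.filter (fun p => ∃ l, IsUTop (dir σ l) F.support p)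
/-- The horizontal maximum of `supp F` (if unique). [folklore] -/
def Hmax (F : Poly2) : Finset Expo := F.support.filter (fun p => ∀ q ∈ F.support, q ≠ p → q 0 < p 0)
/-- The horizontal minimum of `supp F` (if unique). [folklore] -/
def Hmin (F : Poly2) : Finset Expo := F.support.filter (fun p => ∀ q ∈ F.support, q ≠ p → p 0 < q 0)

/-- At most one horizontal maximum. [folklore] -/
theorem card_Hmax_le_one (F : Poly2) : (Hmax F).card ≤ 1 := by
  rw [Finset.card_le_one]
  intro a ha b hb
  obtain ⟨haS, ha'⟩ := Finset.mem_filter.mp ha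
  obtain ⟨hbS, hb'⟩ := Finset.mem_filter.mp hb
  by_contra h
  have h1 := ha' b hbS (Ne.symm h)
  have h2 := hb' a haS h
  omega

/-- At most one horizontal minimum. [folklore] -/
theorem card_Hmin_le_one (F : Poly2) : (Hmin F).card ≤ 1 := by
  rw [Finset.card_le_one]
  intro a ha b hb
  obtain ⟨haS, ha'⟩ := Finset.mem_filter.mp ha
  obtain ⟨hbS, hb'⟩ := Finset.mem_filter.mp hb
  by_contra h
  have h1 := ha' b hbS (Ne.symm h)
  have h2 := hb' a haS h
  omega

/-- `|Tset σ F| ≤ |Eset σ F| + 1`. [val-idea-35 g9] -/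
theorem card_Tset_le {σ : ℝ} (hσ : σ = 1 ∨ σ = -1) (F : Poly2) : (Tset σ F).card ≤ (Eset σ F).card + 1 :=
  card_utop_le hσ F.support (Eset σ F) (fun _ h => (mem_Eset hσ).mpr h) (Tset σ F)
    (fun _ hp => (Finset.mem_filter.mp hp).2)

/-- A linear functional on an embedded exponent is a weight. [folklore] -/
theorem f_emb (f : (Fin 2 → ℝ) →L[ℝ] ℝ) (q : Expo) :
    f (emb q) = wt ![f (Pi.single 0 1), f (Pi.single 1 1)] q := by
  have : emb q = ((q 0 : ℕ) : ℝ) • (Pi.single 0 1 : Fin 2 → ℝ) + ((q 1 : ℕ) : ℝ) • (Pi.single 1 1 : Fin 2 → ℝ) := by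
    ext i; fin_cases i <;> simp [emb]
  rw [this, map_add, map_smul, map_smul]
  simp [wt]
  ring

/-- **Stage B.** Every vertex of `Newt F` is a chart-unique top (some `σ = ±1`) or a horizontal extreme. [val-idea-35 g9] -/
theorem extreme_subset (F : Poly2) :
    Set.extremePoints ℝ (convexHull ℝ (emb '' (F.support : Set Expo))) ⊆
      emb '' ((Tset 1 F ∪ Tset (-1) F ∪ Hmax F ∪ Hmin F : Finset Expo) : Set Expo) := by
  intro v hv
  set S : Set (Fin 2 → ℝ) := emb '' (F.support : Set Expo) with hS
  have hSfin : S.Finite := (F.support.finite_toSet).image emb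
  have hvS : v ∈ S := extremePoints_convexHull_subset hv
  obtain ⟨p, hpS, rfl⟩ := hvS
  have hpS' : p ∈ F.support := hpS
  -- v ∉ convexHull (S \ {v})
  have hnot : emb p ∉ convexHull ℝ (S \ {emb p}) := by
    have h := ((convex_convexHull ℝ S).mem_extremePoints_iff_mem_sdiff_convexHull_sdiff).mp hv
    intro hin
    apply h.2
    refine convexHull_mono ?_ hin
    exact Set.sdiff_subset_sdiff_left (subset_convexHull ℝ S)
  obtain ⟨f, u, hfu, huv⟩ := geometric_hahn_banach_closed_point (convex_convexHull ℝ _)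
    ((hSfin.subset Set.sdiff_subset).isClosed_convexHull ℝ) hnot
  set ν : Fin 2 → ℝ := ![f (Pi.single 0 1), f (Pi.single 1 1)] with hν
  have hstrict : ∀ q ∈ F.support, q ≠ p → wt ν q < wt ν p := by
    intro q hq hqp
    have hq' : emb q ∈ convexHull ℝ (S \ {emb p}) := by
      apply subset_convexHull
      refine ⟨⟨q, hq, rfl⟩, ?_⟩
      intro h; exact hqp (emb_inj h)
    have := hfu _ hq'
    rw [← f_emb, ← f_emb]; linarith
  -- chart reduction
  rw [Finset.coe_union, Finset.coe_union, Finset.coe_union, Set.image_union, Set.image_union, Set.image_union]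
  rcases lt_trichotomy (ν 1) 0 with h1 | h1 | h1
  · -- σ = -1, l = ν0 / (-ν1)
    apply Or.inl; apply Or.inl; apply Or.inr
    refine ⟨p, ?_, rfl⟩
    refine Finset.mem_filter.mpr ⟨hpS', ν 0 / (-ν 1), hpS', fun r hr hrp => ?_⟩
    have := hstrict r hr hrp
    unfold wt at this
    rw [wt_dir, wt_dir]
    have hn : 0 < -ν 1 := by linarith
    have hν1 : ν 1 ≠ 0 := ne_of_lt h1
    rw [← sub_pos]
    have : 0 < (ν 0 * ((p 0 : ℕ) : ℝ) + ν 1 * ((p 1 : ℕ) : ℝ)) - (ν 0 * ((r 0 : ℕ) : ℝ) + ν 1 * ((r 1 : ℕ) : ℝ)) := by linarith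
    have key : (ν 0 / -ν 1 * ((p 0 : ℕ) : ℝ) + -1 * ((p 1 : ℕ) : ℝ)) - (ν 0 / -ν 1 * ((r 0 : ℕ) : ℝ) + -1 * ((r 1 : ℕ) : ℝ))
        = ((ν 0 * ((p 0 : ℕ) : ℝ) + ν 1 * ((p 1 : ℕ) : ℝ)) - (ν 0 * ((r 0 : ℕ) : ℝ) + ν 1 * ((r 1 : ℕ) : ℝ))) / (-ν 1) := by
      field_simp; ring
    rw [key]; exact div_pos this hn
  · -- ν 1 = 0: horizontal
    by_cases h0 : 0 ≤ ν 0
    · apply Or.inl; apply Or.inr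
      refine ⟨p, Finset.mem_filter.mpr ⟨hpS', fun q hq hqp => ?_⟩, rfl⟩
      have := hstrict q hq hqp
      unfold wt at this; rw [h1] at this
      simp only [zero_mul, add_zero] at this
      rcases h0.lt_or_eq with h0 | h0
      · have : ((q 0 : ℕ) : ℝ) < ((p 0 : ℕ) : ℝ) := lt_of_mul_lt_mul_left this h0.le
        exact_mod_cast this
      · exfalso; rw [← h0] at this; simp at this
    · apply Or.inr
      push Not at h0
      refine ⟨p, Finset.mem_filter.mpr ⟨hpS', fun q hq hqp => ?_⟩, rfl⟩
      have := hstrict q hq hqp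
      unfold wt at this; rw [h1] at this
      simp only [zero_mul, add_zero] at this
      have : ((p 0 : ℕ) : ℝ) < ((q 0 : ℕ) : ℝ) := by nlinarith
      exact_mod_cast this
  · -- σ = 1, l = ν0 / ν1
    apply Or.inl; apply Or.inl; apply Or.inl
    refine ⟨p, ?_, rfl⟩
    refine Finset.mem_filter.mpr ⟨hpS', ν 0 / ν 1, hpS', fun r hr hrp => ?_⟩
    have := hstrict r hr hrp
    unfold wt at this
    rw [wt_dir, wt_dir, ← sub_pos]
    have hν1 : ν 1 ≠ 0 := ne_of_gt h1
    have : 0 < (ν 0 * ((p 0 : ℕ) : ℝ) + ν 1 * ((p 1 : ℕ) : ℝ)) - (ν 0 * ((r 0 : ℕ) : ℝ) + ν 1 * ((r 1 : ℕ) : ℝ)) := by linarith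
    have key : (ν 0 / ν 1 * ((p 0 : ℕ) : ℝ) + 1 * ((p 1 : ℕ) : ℝ)) - (ν 0 / ν 1 * ((r 0 : ℕ) : ℝ) + 1 * ((r 1 : ℕ) : ℝ))
        = ((ν 0 * ((p 0 : ℕ) : ℝ) + ν 1 * ((p 1 : ℕ) : ℝ)) - (ν 0 * ((r 0 : ℕ) : ℝ) + ν 1 * ((r 1 : ℕ) : ℝ))) / ν 1 := by
      field_simp
    rw [key]; exact div_pos this h1

/-- `nv F ≤ |Eset 1 F| + |Eset (−1) F| + 4`. [val-idea-35 g9] -/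
theorem nv_le (F : Poly2) : nv F ≤ (Eset 1 F).card + (Eset (-1) F).card + 4 := by
  have hsub := extreme_subset F
  have hfin : (emb '' ((Tset 1 F ∪ Tset (-1) F ∪ Hmax F ∪ Hmin F : Finset Expo) : Set Expo)).Finite :=
    (Finset.finite_toSet _).image emb
  unfold nv
  refine (Set.ncard_le_ncard hsub hfin).trans ?_
  refine (Set.ncard_image_le (Finset.finite_toSet _)).trans ?_
  rw [Set.ncard_coe_finset]
  have h1 := card_Tset_le (σ := 1) (Or.inl rfl) F
  have h2 := card_Tset_le (σ := -1) (Or.inr rfl) F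
  have h3 := card_Hmax_le_one F
  have h4 := card_Hmin_le_one F
  calc (Tset 1 F ∪ Tset (-1) F ∪ Hmax F ∪ Hmin F).card
      ≤ (Tset 1 F).card + (Tset (-1) F).card + (Hmax F).card + (Hmin F).card := by
        refine (Finset.card_union_le _ _).trans (Nat.add_le_add_right ?_ _)
        refine (Finset.card_union_le _ _).trans (Nat.add_le_add_right ?_ _)
        exact Finset.card_union_le _ _
    _ ≤ (Eset 1 F).card + (Eset (-1) F).card + 4 := by omega



end TowerKernel

end Summit.ValiantsHypothesis.ValiantsHypothesis.Theorems.TwoProducts.RankTwoJacobian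

end
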